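import Summits.ResolutionOfSingularities.ResolutionOfSingularities.Theses.SeparableGalois

/-!
# Route SeparableGalois — Assembly (item stmt-ResolutionOfSingularities-18956)

The assembly item of route `SeparableGalois` reads

  `Assembly := GaloisQuotientModels → WildQuotientResolution → DescentPerfectToAll →
    ResolutionOfSingularities`.

Proof (the same chain as the route's deciding theorem `SeparableGalois.closes`, given explicitly so
that this file does not depend on the gate-regenerated deciding theorem keeping its name): unfold
`ResolutionOfSingularities_iff` and fix a prime `p`; `DescentPerfectToAll p hp` reduces
`ResolutionInChar p` to reduced separated finite-type `X` over a PERFECT field `k`; the Literature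
lemma `ComponentGluing.hasResolution_of_forall_closeds` (Cossart–Piltant 2019, Prop. 4.6 Step 1)
reduces to the integral closed subschemes `Z ↪ X` (again separated of finite type over `k`);
`GaloisQuotientModels` gives a proper birational `π : X₁ → Z` together with its Galois-quotient
presentation `q : X′ → X₁`; `WildQuotientResolution` resolves `X₁` (its structure map
`X₁ → Z → X → Spec k` is separated, locally of finite type and quasi-compact by composition); and
`ComponentGluing.Scheme.HasResolution.of_isBirational` transports that resolution down `π`.
All the mathematics of the route lives in the three hypotheses (items stmt-18955, stmt-15640,
stmt-0549); this file only records that the route closes.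
-/

-- single-problem summit: the doubled namespace component `ResolutionOfSingularities` is forced
set_option linter.dupNamespace false

namespace Summit.ResolutionOfSingularities.ResolutionOfSingularities.Theorems

open Summit.ResolutionOfSingularities.ResolutionOfSingularities.Theses.SeparableGalois

/-- **Assembly of route SeparableGalois** (item stmt-ResolutionOfSingularities-18956): birational
Galois-quotient models over perfect fields (`GaloisQuotientModels`), resolution of Galois-type
quotients of regular schemes (`WildQuotientResolution`) and descent from perfect fields to all
fields (`DescentPerfectToAll`) together give `ResolutionOfSingularities`. Proof: descent to a
perfect ground field, gluing over the integral closed subschemes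
(`ComponentGluing.hasResolution_of_forall_closeds`), the Galois-quotient model of each such
subscheme, resolution of the quotient, transport down the proper birational model map
(`ComponentGluing.Scheme.HasResolution.of_isBirational`). [folklore] -/
theorem separableGalois_assembly_proof :
    Summit.ResolutionOfSingularities.ResolutionOfSingularities.Theses.SeparableGalois.Assembly := by
  unfold Assembly
  intro hW hK hD
  refine _root_.ResolutionOfSingularities_iff.mpr fun p hp => hD p hp ?_
  intro k _ _ _ X f hs hl hq hr
  refine Literature.AlgebraicGeometry.Resolution.ComponentGluing.hasResolution_of_forall_closeds X f
    fun Z hZ => ?_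
  haveI := hZ
  obtain ⟨X₁, X', π, q, G, _, _, ρ, hπ, hbir, h1, h2, hreg, hfin, hsurj, het, hinv, horb⟩ :=
    hW p hp k _ (CategoryTheory.CategoryStruct.comp
      (AlgebraicGeometry.Scheme.IdealSheafData.vanishingIdeal Z).subschemeι f)
      inferInstance inferInstance inferInstance hZ
  have hres : Literature.AlgebraicGeometry.Resolution.Scheme.HasResolution X₁ :=
    hK p hp k X' X₁ (CategoryTheory.CategoryStruct.comp π (CategoryTheory.CategoryStruct.comp
      (AlgebraicGeometry.Scheme.IdealSheafData.vanishingIdeal Z).subschemeι f)) q G ρ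
      inferInstance inferInstance inferInstance h1 h2 hreg hfin hsurj het hinv horb
  exact Literature.AlgebraicGeometry.Resolution.ComponentGluing.Scheme.HasResolution.of_isBirational
    π hbir hres
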